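import Mathlib
import Literature.NumberTheory.Transcendental.KZCalculusProofs
import Literature.NumberTheory.Transcendental.KZLogCalculusProofs
import Literature.NumberTheory.Transcendental.KZSemialgebraicComplex
import Literature.NumberTheory.Transcendental.KZIdealTetrahedron
import Literature.NumberTheory.Transcendental.KZIntervalPeriodProofs
import Summits.KontsevichZagierPeriods.KontsevichZagierPeriods.Theorems.HyperbolicBlochOffTetraSectorKernelStubEulerReflection
import Summits.KontsevichZagierPeriods.KontsevichZagierPeriods.Theorems.HyperbolicBlochOffTetraSectorKernelStubAffineOrbit
import Summits.KontsevichZagierPeriods.KontsevichZagierPeriods.Theorems.HyperbolicBlochOffTetraSectorKernelStubLogRectInvert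
import Summits.KontsevichZagierPeriods.KontsevichZagierPeriods.Theorems.HyperbolicBlochOffTetraSectorKernelStubDilogOneExists
import Summits.KontsevichZagierPeriods.KontsevichZagierPeriods.Theorems.HyperbolicBlochOffTetraSectorKernelAbelFiveTermAux

/-!
# `OffTetraSectorKernel`, line `odd-hyperbolic-ladder` (v9): the reflection relation of the real Bloch group

`R(x) + R(1−x) − 2·R(½) ∈ KZ.relations` for real algebraic `0 < x < 1`, where
`R(a) = 2·[T a] + [N(1/a, 1/(1−a))]` is the Rogers carrier (value `2L(a)`; `L(x) + L(1−x) = L(1) = 2L(½)`).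
Chain of moves: Euler's reflection at `x` and at `½` (`stub_eulerReflection`, c6; the `Li₂(1)`-triangle now
EXISTS, `stub_dilogOneExists`), the log rectangles moved onto Euler's rectangles `{x<u<1, 0<v<x}` by
`(u,v) ↦ (1/u, 1/(1−v))` (`stub_logRectInvert`), and the involution `(u,v) ↦ (1−v, 1−u)` identifying the
Euler rectangles at `x` and at `1−x` (rule (2), `aff_orbit_of_sub_of_mem_changeOfVariablesRel`).

References: L. Euler (1768); L. J. Rogers, Proc. LMS (2) 4 (1907); M. Kontsevich, D. Zagier, *Periods*
(2001), §1.2.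
-/

noncomputable section

open Set MeasureTheory
open Literature.NumberTheory.Transcendental Literature.ModelTheory.ExponentialFields

namespace Summit.KontsevichZagierPeriods.HyperbolicBloch.OffTetraSectorKernel

/-- **Euler rectangles exist**: `[{a < u < 1, 0 < v < a}, 1/(u(1−v))]` (value `log a · log(1−a)`) is an
integral representation for real algebraic `0 < a < 1` (integrand bounded by `1/(a(1−a))`).
[cite: KontsevichZagier2001, §1.1] -/
theorem exists_eulerRect {a : ℝ} (ha : IsAlgebraic ℚ a) (ha0 : 0 < a) (ha1 : a < 1) :
    ∃ P : KZ.IntegralRep 2, P.domain = {w | a < w 0 ∧ w 0 < 1 ∧ 0 < w 1 ∧ w 1 < a} ∧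
      P.integrand = fun w => 1 / (w 0 * (1 - w 1)) := by
  have hσ := abel_isSemialgebraic_rect ha isAlgebraic_one isAlgebraic_zero ha
  refine abel_exists_rep_of_bounded hσ (abel_isBounded_of_abs_le 1 ?_) ?_ (C := 1 / (a * (1 - a))) ?_
  · rintro w ⟨h1, h2, h3, h4⟩ i
    fin_cases i
    · exact abs_le.2 ⟨by simp; linarith, by simp; linarith⟩
    · exact abs_le.2 ⟨by simp; linarith, by simp; linarith⟩
  · have h1 : IsSemialgebraicFunOn ℚ {w : Fin 2 → ℝ | a < w 0 ∧ w 0 < 1 ∧ 0 < w 1 ∧ w 1 < a}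
        (fun _ : Fin 2 → ℝ => (1 : ℝ)) := by
      simpa using isSemialgebraicFunOn_ratCast hσ 1
    refine h1.div (IsSemialgebraicFunOn.mul_holds (isSemialgebraicFunOn_apply hσ 0)
      ((IsSemialgebraicFunOn.sub_holds h1 (isSemialgebraicFunOn_apply hσ 1)).congr fun w _ => by simp))
      fun w hw => ?_
    obtain ⟨h1, -, -, h4⟩ := hw
    exact mul_ne_zero (by linarith) (by show 1 - w 1 ≠ 0; linarith)
  · rintro w ⟨h1, h2, h3, h4⟩
    have hpos : 0 < w 0 * (1 - w 1) := mul_pos (by linarith) (by linarith)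
    rw [abs_of_pos (one_div_pos.2 hpos)]
    apply one_div_le_one_div_of_le (mul_pos ha0 (by linarith))
    exact mul_le_mul h1.le (by linarith) (by linarith) (by linarith)

/-- **The involution `(u,v) ↦ (1−v, 1−u)` identifies the Euler rectangles at `x` and at `1−x`**
(`{x<u<1, 0<v<x} → {1−x<u<1, 0<v<1−x}`, `|det| = 1`, integrand `1/(u(1−v))` preserved): ONE move.
[cite: KontsevichZagier2001, §1.2 rule (2)] -/
theorem eulerRect_involution_mem {x : ℝ} (P P' : KZ.IntegralRep 2)
    (hP : P.domain = {w | x < w 0 ∧ w 0 < 1 ∧ 0 < w 1 ∧ w 1 < x})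
    (hPi : EqOn P.integrand (fun w => 1 / (w 0 * (1 - w 1))) P.domain)
    (hP' : P'.domain = {w | 1 - x < w 0 ∧ w 0 < 1 ∧ 0 < w 1 ∧ w 1 < 1 - x})
    (hP'i : EqOn P'.integrand (fun w => 1 / (w 0 * (1 - w 1))) P'.domain) :
    KZ.of P - KZ.of P' ∈ KZ.relations := by
  refine KZ.changeOfVariablesRel_subset_relations
    (aff_orbit_of_sub_of_mem_changeOfVariablesRel (!![(0 : ℝ), -1; -1, 0]) (fun _ => (1 : ℝ))
      eulerReflection_matrix_isAlgebraic (fun _ => isAlgebraic_one)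
      (by rw [eulerReflection_matrix_det]; norm_num) P P' ?_ ?_)
  · rw [hP', hP, show (fun w : Fin 2 → ℝ =>
        (!![(0 : ℝ), -1; -1, 0] : Matrix (Fin 2) (Fin 2) ℝ).mulVec w + fun _ => (1 : ℝ)) =
        fun w => ![1 - w 1, 1 - w 0] from funext eulerReflection_affine_apply]
    ext u
    simp only [mem_image, mem_setOf_eq]
    constructor
    · rintro ⟨h1, h2, h3, h4⟩
      refine ⟨![1 - u 1, 1 - u 0], ⟨by simp; linarith, by simp; linarith, by simp; linarith, by simp; linarith⟩, ?_⟩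
      ext i
      fin_cases i <;> simp
    · rintro ⟨w, ⟨h1, h2, h3, h4⟩, rfl⟩
      simp only [Matrix.cons_val_zero, Matrix.cons_val_one]
      exact ⟨by linarith, by linarith, by linarith, by linarith⟩
  · intro w hw
    have hw' := hw
    rw [hP] at hw'
    obtain ⟨h1, h2, h3, h4⟩ := hw'
    have hιw : (!![(0 : ℝ), -1; -1, 0] : Matrix (Fin 2) (Fin 2) ℝ).mulVec w + (fun _ => (1 : ℝ)) ∈ P'.domain := by
      rw [eulerReflection_affine_apply, hP']
      simp only [mem_setOf_eq, Matrix.cons_val_zero, Matrix.cons_val_one]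
      exact ⟨by linarith, by linarith, by linarith, by linarith⟩
    rw [hPi hw, hP'i hιw, eulerReflection_affine_apply, eulerReflection_matrix_det]
    simp only [Matrix.cons_val_zero, Matrix.cons_val_one, abs_neg, abs_one, mul_one]
    ring

/-- **THE REFLECTION RELATION OF THE REAL BLOCH GROUP INSIDE THE CALCULUS**: for real algebraic
`0 < x < 1` and ANY Rogers carriers at `x`, `1−x`, `½`,
`R(x) + R(1−x) − 2·R(½) ∈ KZ.relations` (`R(a) = 2[T a] + [N(1/a, 1/(1−a))]`; value
`2(L(x) + L(1−x) − 2L(½)) = 0`). Euler's reflection at `x` and at `½` (`stub_eulerReflection`), the three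
log rectangles inverted onto Euler rectangles (`stub_logRectInvert`), the Euler rectangles at `x` and `1−x`
identified by the involution; everything auxiliary cancels: `−2E₁ + 2E₂ − I₁ − I₂ − ι + 2I₃`.
[cite: KontsevichZagier2001, §1.2] -/
theorem rogersReflection_mem_relations :
    ∀ (x : ℝ), IsAlgebraic ℚ x → 0 < x → x < 1 →
    ∀ (Lx L1x Lh Nx N1x Nh : KZ.IntegralRep 2),
      Lx.domain = {w | 0 < w 1 ∧ w 1 < w 0 ∧ w 0 < x} →
      Set.EqOn Lx.integrand (fun w => 1 / (w 0 * (1 - w 1))) Lx.domain →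
      L1x.domain = {w | 0 < w 1 ∧ w 1 < w 0 ∧ w 0 < 1 - x} →
      Set.EqOn L1x.integrand (fun w => 1 / (w 0 * (1 - w 1))) L1x.domain →
      Lh.domain = {w | 0 < w 1 ∧ w 1 < w 0 ∧ w 0 < 1 / 2} →
      Set.EqOn Lh.integrand (fun w => 1 / (w 0 * (1 - w 1))) Lh.domain →
      Nx.domain = {w | 1 < w 0 ∧ w 0 < 1 / x ∧ 1 < w 1 ∧ w 1 < 1 / (1 - x)} →
      Set.EqOn Nx.integrand (fun w => 1 / (w 0 * w 1)) Nx.domain →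
      N1x.domain = {w | 1 < w 0 ∧ w 0 < 1 / (1 - x) ∧ 1 < w 1 ∧ w 1 < 1 / (1 - (1 - x))} →
      Set.EqOn N1x.integrand (fun w => 1 / (w 0 * w 1)) N1x.domain →
      Nh.domain = {w | 1 < w 0 ∧ w 0 < 1 / (1 / 2) ∧ 1 < w 1 ∧ w 1 < 1 / (1 - 1 / 2)} →
      Set.EqOn Nh.integrand (fun w => 1 / (w 0 * w 1)) Nh.domain →
      ((2 : ℕ) • KZ.of Lx + KZ.of Nx) + ((2 : ℕ) • KZ.of L1x + KZ.of N1x) -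
        (2 : ℕ) • ((2 : ℕ) • KZ.of Lh + KZ.of Nh) ∈ KZ.relations := by
  intro x hx hx0 hx1 Lx L1x Lh Nx N1x Nh hLx hLxi hL1x hL1xi hLh hLhi hNx hNxi hN1x hN1xi hNh hNhi
  have h1x : IsAlgebraic ℚ (1 - x) := isAlgebraic_one.sub hx
  have hh : IsAlgebraic ℚ (1 / 2 : ℝ) := by
    rw [show (1 / 2 : ℝ) = ((1 / 2 : ℚ) : ℝ) by push_cast; ring]; exact isAlgebraic_algebraMap _
  obtain ⟨L₁, hL₁d, hL₁i⟩ := stub_dilogOneExists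
  obtain ⟨Px, hPxd, hPxi⟩ := exists_eulerRect hx hx0 hx1
  obtain ⟨P1x, hP1xd, hP1xi⟩ := exists_eulerRect h1x (by linarith) (by linarith)
  obtain ⟨Ph, hPhd, hPhi⟩ := exists_eulerRect hh (by norm_num) (by norm_num)
  -- Euler's reflection at `x` and at `½`
  have E1 : KZ.of L₁ - KZ.of Lx - KZ.of Px - KZ.of L1x ∈ KZ.relations :=
    stub_eulerReflection x hx hx0 hx1 L₁ Lx Px L1x hL₁d (fun w _ => by rw [hL₁i]) hLx hLxi hPxd
      (fun w _ => by rw [hPxi]) hL1x hL1xi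
  have E2 : KZ.of L₁ - KZ.of Lh - KZ.of Ph - KZ.of Lh ∈ KZ.relations :=
    stub_eulerReflection (1 / 2) hh (by norm_num) (by norm_num) L₁ Lh Ph Lh hL₁d (fun w _ => by rw [hL₁i])
      hLh hLhi hPhd (fun w _ => by rw [hPhi]) (by rw [hLh]; norm_num) hLhi
  -- the log rectangles are Euler rectangles
  have I1 : KZ.of Px - KZ.of Nx ∈ KZ.relations :=
    stub_logRectInvert x hx hx0 hx1 Px Nx hPxd (fun w _ => by rw [hPxi]) hNx hNxi
  have I2 : KZ.of P1x - KZ.of N1x ∈ KZ.relations :=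
    stub_logRectInvert (1 - x) h1x (by linarith) (by linarith) P1x N1x hP1xd (fun w _ => by rw [hP1xi])
      hN1x hN1xi
  have I3 : KZ.of Ph - KZ.of Nh ∈ KZ.relations :=
    stub_logRectInvert (1 / 2) hh (by norm_num) (by norm_num) Ph Nh hPhd (fun w _ => by rw [hPhi]) hNh hNhi
  -- the Euler rectangles at `x` and `1 − x` coincide
  have INV : KZ.of Px - KZ.of P1x ∈ KZ.relations :=
    eulerRect_involution_mem Px P1x hPxd (fun w _ => by rw [hPxi]) hP1xd (fun w _ => by rw [hP1xi])
  have : ((2 : ℕ) • KZ.of Lx + KZ.of Nx) + ((2 : ℕ) • KZ.of L1x + KZ.of N1x) -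
      (2 : ℕ) • ((2 : ℕ) • KZ.of Lh + KZ.of Nh) =
      -((2 : ℕ) • (KZ.of L₁ - KZ.of Lx - KZ.of Px - KZ.of L1x)) +
      (2 : ℕ) • (KZ.of L₁ - KZ.of Lh - KZ.of Ph - KZ.of Lh) - (KZ.of Px - KZ.of Nx) -
      (KZ.of P1x - KZ.of N1x) - (KZ.of Px - KZ.of P1x) + (2 : ℕ) • (KZ.of Ph - KZ.of Nh) := by
    simp only [smul_add, smul_sub]
    abel
  rw [this]
  exact KZ.relations.add_mem (KZ.relations.sub_mem (KZ.relations.sub_mem (KZ.relations.sub_mem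
    (KZ.relations.add_mem (KZ.relations.neg_mem (KZ.relations.nsmul_mem E1 2))
    (KZ.relations.nsmul_mem E2 2)) I1) I2) INV) (KZ.relations.nsmul_mem I3 2)

end Summit.KontsevichZagierPeriods.HyperbolicBloch.OffTetraSectorKernel

end
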